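import Summits.KontsevichZagierPeriods.KontsevichZagierPeriods.Theorems.SoloInformedKZPOneKCharts
import HarnessLib
import HarnessLib.Audit

/-!
# SoloInformed — the rational parametrisation of the circle as one move; the period conjecture for integrands rational in `(x, √(1−x²))`

Solo programme `solo-KontsevichZagierPeriods-informed`, session s112, file 25.

The map `Φ(t) = (1 − t²)/(1 + t²)` is a bijection from the half-line `t ≥ 0` onto `(−1, 1]`, with
inverse `τ(x) = √((1 − x)/(1 + x))` and `|Φ'(t)| = 4t/(1 + t²)²`; it is a rational map with
rational coefficients, hence `ℚ`-semialgebraic, and for ANY representation `R = [D, f]` of dimension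
`1` with `D ⊆ (−1, 1]` the pulled-back representation `R' = [ {t ≥ 0 | Φ(t) ∈ D}, f(Φ(t)) |Φ'(t)| ]`
satisfies `[R'] − [R] ∈ changeOfVariablesRel` (ONE move of rule (2); `soloInformed_exists_circSubst`;
semialgebraicity of the new domain by Tarski–Seidenberg, `soloInformed_isSemialgebraic_sep_mapsTo`).
Since `x = (1 − τ²)/(1 + τ²)` and `√(1 − x²) = 2τ/(1 + τ²)`, a function rational in
`(x, √(1 − x²))` with real algebraic coefficients is `P(τ(x))/Q(τ(x))` with `P, Q ∈ K[X]`
(`K = algebraicClosure ℚ ℝ`): this is the class `SoloInformedIsKCircleOne`; after the substitution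
the integrand is `4t P(t) / ((1 + t²)² Q(t))`, `K`-rational, so the representation lies in the span
of points and segments (file 18).  Consequence (`soloInformed_kzp_isKCircleOne`): **the
Kontsevich–Zagier period conjecture holds between any two absolutely convergent integrals of
functions rational in `(x, √(1 − x²))` with real algebraic coefficients over `ℚ`-semialgebraic
`D, D' ⊆ (−1, 1]`, and between these and the `K`-rational / rational representations of dimension
`≤ 1`, whenever the values agree** — the class of Kontsevich–Zagier's own worked example
`π = 2 ∫_{−1}^{1} √(1 − x²) dx = ∫_{−1}^{1} dx/√(1 − x²) = ∫ dx/(1 + x²)` [KZ 2001, §1.1]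
(`soloInformed_isKCircleOne_sqrt`, `soloInformed_isKCircleOne_inv_sqrt`).

References: M. Kontsevich, D. Zagier, *Periods* (2001), §1.1, §1.2 rule (2); Bochnak–Coste–Roy
(1998), Prop. 2.2.7 (images under semialgebraic maps); A. Baker (1975), Thm. 2.1.
-/

noncomputable section

open scoped BigOperators Polynomial

namespace Summit.KontsevichZagierPeriods.KontsevichZagierPeriods.Theorems

open Set MeasureTheory
open Literature.ModelTheory.ExponentialFields
open Literature.NumberTheory.Transcendental Literature.NumberTheory.Transcendental.KZ

/-! ## A Tarski–Seidenberg lemma: `{x ∈ s | f x ∈ D}` is semialgebraic -/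

/-- For a `ℚ`-semialgebraic map `f` on `s` and a `ℚ`-semialgebraic `D`, the set
`{x ∈ s | f x ∈ D}` is `ℚ`-semialgebraic (projection of `graph f ∩ (ℝ^m × D)`).
[BCR 1998, Prop. 2.2.7] -/
theorem soloInformed_isSemialgebraic_sep_mapsTo {m n : ℕ} {s : Set (Fin m → ℝ)}
    {f : (Fin m → ℝ) → (Fin n → ℝ)} (hf : IsSemialgebraicMapOn ℚ s f) {D : Set (Fin n → ℝ)}
    (hD : IsSemialgebraic ℚ D) : IsSemialgebraic ℚ {x | x ∈ s ∧ f x ∈ D} := by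
  have hW : IsSemialgebraic ℚ ({z : Fin (m + n) → ℝ | ∃ x ∈ s, z = Fin.append x (f x)} ∩
      (fun z : Fin (m + n) → ℝ => z ∘ Fin.natAdd m) ⁻¹' D) :=
    IsSemialgebraic.inter hf (hD.preimage_comp (Fin.natAdd m))
  convert hW.image_comp (Fin.castAdd n) using 1
  ext x
  simp only [mem_image, mem_inter_iff, mem_setOf_eq, mem_preimage]
  constructor
  · rintro ⟨hx, hfx⟩
    refine ⟨Fin.append x (f x), ⟨⟨x, hx, rfl⟩, ?_⟩, ?_⟩
    · have : (Fin.append x (f x) ∘ Fin.natAdd m) = f x := funext fun i => Fin.append_right x (f x) i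
      rw [this]; exact hfx
    · exact funext fun i => Fin.append_left x (f x) i
  · rintro ⟨z, ⟨⟨x', hx', rfl⟩, hzD⟩, hzx⟩
    have hx : x' = x := by
      rw [← hzx]; exact (funext fun i => Fin.append_left x' (f x') i).symm
    subst hx
    have : (Fin.append x' (f x') ∘ Fin.natAdd m) = f x' := funext fun i => Fin.append_right x' (f x') i
    rw [this] at hzD
    exact ⟨hx', hzD⟩

/-! ## The circle parametrisation -/

/-- `Φ(t) = (1 − t²)/(1 + t²)` in the coordinates `Fin 1 → ℝ`. -/
def soloInformedCircMap (w : Fin 1 → ℝ) : Fin 1 → ℝ := fun _ => (1 - w 0 * w 0) / (1 + w 0 * w 0)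

/-- The derivative of `Φ` at `w`: `(−4 w₀/(1 + w₀²)²) • id`. -/
def soloInformedCircDeriv (w : Fin 1 → ℝ) : (Fin 1 → ℝ) →L[ℝ] (Fin 1 → ℝ) :=
  ((-4 * w 0) / (1 + w 0 * w 0) ^ 2) • ContinuousLinearMap.id ℝ (Fin 1 → ℝ)

/-- `τ(x) = √((1 − x)/(1 + x))`, the inverse of `Φ` on `(−1, 1]`. -/
def soloInformedCircInv (x : ℝ) : ℝ := Real.sqrt ((1 - x) / (1 + x))

/-- Pointwise formula. -/
@[simp] theorem soloInformed_circMap_apply (w : Fin 1 → ℝ) (i : Fin 1) :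
    soloInformedCircMap w i = (1 - w 0 * w 0) / (1 + w 0 * w 0) := rfl

/-- `1 + s² ≠ 0`. -/
theorem soloInformed_one_add_mul_self_ne_zero (s : ℝ) : 1 + s * s ≠ 0 :=
  (add_pos_of_pos_of_nonneg one_pos (mul_self_nonneg s)).ne'

/-- The scalar derivative of `s ↦ (1 − s²)/(1 + s²)`. -/
theorem soloInformed_hasDerivAt_circ (s : ℝ) :
    HasDerivAt (fun y : ℝ => (1 - y * y) / (1 + y * y)) ((-4 * s) / (1 + s * s) ^ 2) s := by
  have hsq : HasDerivAt (fun y : ℝ => y * y) (1 * s + s * 1) s := (hasDerivAt_id s).mul (hasDerivAt_id s)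
  have hc : HasDerivAt (fun y : ℝ => 1 - y * y) (0 - (1 * s + s * 1)) s := (hasDerivAt_const s 1).sub hsq
  have hd : HasDerivAt (fun y : ℝ => 1 + y * y) (0 + (1 * s + s * 1)) s := (hasDerivAt_const s 1).add hsq
  refine (hc.div hd (soloInformed_one_add_mul_self_ne_zero s)).congr_deriv ?_
  field_simp
  ring

/-- `Φ` is differentiable with the stated derivative. -/
theorem soloInformed_hasFDerivAt_circMap (w : Fin 1 → ℝ) :
    HasFDerivAt soloInformedCircMap (soloInformedCircDeriv w) w := by
  rw [hasFDerivAt_pi']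
  intro i
  have h1 : HasFDerivAt (fun w : Fin 1 → ℝ => w 0)
      (ContinuousLinearMap.proj (R := ℝ) (φ := fun _ : Fin 1 => ℝ) 0) w :=
    (ContinuousLinearMap.proj (R := ℝ) (φ := fun _ : Fin 1 => ℝ) 0).hasFDerivAt
  have h2 := (soloInformed_hasDerivAt_circ (w 0)).comp_hasFDerivAt w h1
  refine h2.congr_fderiv ?_
  ext v
  simp [soloInformedCircDeriv, Fin.fin_one_eq_zero i]

/-- The Jacobian determinant of `Φ`. -/
theorem soloInformed_det_circDeriv (w : Fin 1 → ℝ) :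
    (soloInformedCircDeriv w).det = (-4 * w 0) / (1 + w 0 * w 0) ^ 2 := by
  unfold soloInformedCircDeriv
  rw [ContinuousLinearMap.det, ContinuousLinearMap.toLinearMap_smul, ContinuousLinearMap.coe_id,
    LinearMap.det_smul, LinearMap.det_id, Module.finrank_fin_fun]
  simp

/-- `|det Φ'(t)| = 4t/(1 + t²)²` for `t ≥ 0`. -/
theorem soloInformed_abs_det_circDeriv {w : Fin 1 → ℝ} (hw : 0 ≤ w 0) :
    |(soloInformedCircDeriv w).det| = 4 * w 0 / (1 + w 0 * w 0) ^ 2 := by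
  rw [soloInformed_det_circDeriv, abs_div, abs_of_nonpos (by nlinarith), abs_of_nonneg (sq_nonneg _)]
  ring

/-- `Φ` is `ℚ`-semialgebraic on every `ℚ`-semialgebraic set (a rational map). -/
theorem soloInformed_isSemialgebraicMapOn_circMap {s : Set (Fin 1 → ℝ)} (hs : IsSemialgebraic ℚ s) :
    IsSemialgebraicMapOn ℚ s soloInformedCircMap := by
  refine IsSemialgebraicMapOn.of_forall hs fun i => ?_
  refine (isSemialgebraicFunOn_aeval_div_aeval hs (1 - MvPolynomial.X 0 ^ 2 : MvPolynomial (Fin 1) ℚ)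
    (1 + MvPolynomial.X 0 ^ 2) fun v _ => ?_).congr fun v _ => ?_
  · simp only [map_add, map_one, map_pow, MvPolynomial.aeval_X]; positivity
  · show (MvPolynomial.aeval v (1 - MvPolynomial.X 0 ^ 2 : MvPolynomial (Fin 1) ℚ) : ℝ) /
        MvPolynomial.aeval v (1 + MvPolynomial.X 0 ^ 2 : MvPolynomial (Fin 1) ℚ) = soloInformedCircMap v i
    simp [soloInformedCircMap, pow_two]

/-- `Φ` is injective on `{t | 0 ≤ t 0}`. -/
theorem soloInformed_injOn_circMap {s : Set (Fin 1 → ℝ)} (hs : ∀ w ∈ s, 0 ≤ w 0) :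
    InjOn soloInformedCircMap s := by
  intro a ha b hb h
  have h0 : (1 - a 0 * a 0) / (1 + a 0 * a 0) = (1 - b 0 * b 0) / (1 + b 0 * b 0) := congr_fun h 0
  rw [div_eq_div_iff (soloInformed_one_add_mul_self_ne_zero _)
    (soloInformed_one_add_mul_self_ne_zero _)] at h0
  have hsq : a 0 * a 0 = b 0 * b 0 := by nlinarith [h0]
  have hab : a 0 = b 0 := by
    rcases mul_self_eq_mul_self_iff.1 hsq with h | h
    · exact h
    · have ha0 := hs a ha; have hb0 := hs b hb
      have : a 0 = 0 := by linarith
      linarith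
  rw [KZ.eq_const_apply_zero a, KZ.eq_const_apply_zero b, hab]

/-- On `(−1, 1]`: `τ(x) ≥ 0`, `τ(x)² = (1 − x)/(1 + x)` and `Φ(τ(x)) = x`. -/
theorem soloInformed_circMap_circInv {x : ℝ} (hx1 : -1 < x) (hx2 : x ≤ 1) :
    0 ≤ soloInformedCircInv x ∧
      soloInformedCircInv x * soloInformedCircInv x = (1 - x) / (1 + x) ∧
      (1 - soloInformedCircInv x * soloInformedCircInv x) /
        (1 + soloInformedCircInv x * soloInformedCircInv x) = x := by
  have hpos : 0 < 1 + x := by linarith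
  have hnn : 0 ≤ (1 - x) / (1 + x) := div_nonneg (by linarith) hpos.le
  have hsq : soloInformedCircInv x * soloInformedCircInv x = (1 - x) / (1 + x) :=
    Real.mul_self_sqrt hnn
  refine ⟨Real.sqrt_nonneg _, hsq, ?_⟩
  rw [hsq]
  field_simp
  ring

/-- For `t ≥ 0`: `τ(Φ(t)) = t`. -/
theorem soloInformed_circInv_circMap {t : ℝ} (ht : 0 ≤ t) :
    soloInformedCircInv ((1 - t * t) / (1 + t * t)) = t := by
  unfold soloInformedCircInv
  have h : (1 - (1 - t * t) / (1 + t * t)) / (1 + (1 - t * t) / (1 + t * t)) = t * t := by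
    have := soloInformed_one_add_mul_self_ne_zero t
    field_simp
    ring
  rw [h]
  exact Real.sqrt_mul_self ht

/-- `Φ(t) ∈ (−1, 1]` for every real `t`. -/
theorem soloInformed_circMap_mem (t : ℝ) :
    -1 < (1 - t * t) / (1 + t * t) ∧ (1 - t * t) / (1 + t * t) ≤ 1 := by
  have hpos : 0 < 1 + t * t := add_pos_of_pos_of_nonneg one_pos (mul_self_nonneg t)
  constructor
  · rw [lt_div_iff₀ hpos]; nlinarith
  · rw [div_le_iff₀ hpos]; nlinarith

/-- `Φ` maps `{t ≥ 0 | Φ(t) ∈ D}` ONTO `D` when `D ⊆ (−1, 1]`. -/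
theorem soloInformed_circMap_image {D : Set (Fin 1 → ℝ)} (hD : ∀ x ∈ D, -1 < x 0 ∧ x 0 ≤ 1) :
    soloInformedCircMap '' {t | t ∈ {t : Fin 1 → ℝ | 0 ≤ t 0} ∧ soloInformedCircMap t ∈ D} = D := by
  ext x
  constructor
  · rintro ⟨t, ht, rfl⟩
    exact ht.2
  · intro hx
    obtain ⟨h1, h2⟩ := hD x hx
    obtain ⟨hτ0, -, hΦτ⟩ := soloInformed_circMap_circInv h1 h2
    have hpt : soloInformedCircMap (fun _ => soloInformedCircInv (x 0)) = x := by
      funext i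
      rw [soloInformed_circMap_apply, hΦτ, Fin.fin_one_eq_zero i]
    refine ⟨fun _ => soloInformedCircInv (x 0), ⟨hτ0, ?_⟩, hpt⟩
    show soloInformedCircMap (fun _ => soloInformedCircInv (x 0)) ∈ D
    rw [hpt]; exact hx

/-! ## The circle substitution move -/

/-- **The substitution `x = (1 − t²)/(1 + t²)` is one change-of-variables move.** For `R = [D, f]`
of dimension `1` with `D ⊆ (−1, 1]` there is a representation
`R' = [ {t ≥ 0 | Φ(t) ∈ D}, f(Φ(t)) |Φ'(t)| ]` with `[R'] − [R] ∈ changeOfVariablesRel`.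
[Kontsevich–Zagier 2001, §1.2 rule (2)] -/
theorem soloInformed_exists_circSubst (R : IntegralRep 1)
    (hD : ∀ x ∈ R.domain, -1 < x 0 ∧ x 0 ≤ 1) :
    ∃ R' : IntegralRep 1,
      R'.domain = {t | t ∈ {t : Fin 1 → ℝ | 0 ≤ t 0} ∧ soloInformedCircMap t ∈ R.domain} ∧
      (R'.integrand = fun t => R.integrand (soloInformedCircMap t) *
        |(soloInformedCircDeriv t).det|) ∧
      of R' - of R ∈ changeOfVariablesRel := by
  have hS₀ : IsSemialgebraic ℚ {t : Fin 1 → ℝ | 0 ≤ t 0} := by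
    have h := IsSemialgebraicFunOn.isSemialgebraic_sep_nonneg
      (Literature.NumberTheory.Transcendental.isSemialgebraicFunOn_apply
        (isSemialgebraic_univ : IsSemialgebraic ℚ (univ : Set (Fin 1 → ℝ))) 0)
    convert h using 1
    ext t; simp
  set S : Set (Fin 1 → ℝ) := {t | t ∈ {t : Fin 1 → ℝ | 0 ≤ t 0} ∧ soloInformedCircMap t ∈ R.domain}
    with hSdef
  have hS : IsSemialgebraic ℚ S :=
    soloInformed_isSemialgebraic_sep_mapsTo (soloInformed_isSemialgebraicMapOn_circMap hS₀)
      R.isSemialgebraic_domain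
  have hS0 : ∀ t ∈ S, 0 ≤ t 0 := fun t ht => ht.1
  have hmaps : ∀ t ∈ S, soloInformedCircMap t ∈ R.domain := fun t ht => ht.2
  have hΦ : IsSemialgebraicMapOn ℚ S soloInformedCircMap := soloInformed_isSemialgebraicMapOn_circMap hS
  have hderiv : ∀ t ∈ S, HasFDerivWithinAt soloInformedCircMap (soloInformedCircDeriv t) S t :=
    fun t _ => (soloInformed_hasFDerivAt_circMap t).hasFDerivWithinAt
  have hinj : InjOn soloInformedCircMap S := soloInformed_injOn_circMap hS0
  have himage : soloInformedCircMap '' S = R.domain := soloInformed_circMap_image hD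
  -- on `S` the Jacobian is the rational function `4t/(1+t²)²`
  have hjac : IsSemialgebraicFunOn ℚ S (fun t => |(soloInformedCircDeriv t).det|) := by
    refine (isSemialgebraicFunOn_aeval_div_aeval hS
      (MvPolynomial.C (4 : ℚ) * MvPolynomial.X 0 : MvPolynomial (Fin 1) ℚ)
      ((1 + MvPolynomial.X 0 ^ 2) ^ 2) fun v _ => by
        simp only [map_pow, map_add, map_one, MvPolynomial.aeval_X]; positivity).congr
      fun t ht => ?_
    show (MvPolynomial.aeval t (MvPolynomial.C (4 : ℚ) * MvPolynomial.X 0 : MvPolynomial (Fin 1) ℚ) : ℝ) /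
        MvPolynomial.aeval t ((1 + MvPolynomial.X 0 ^ 2) ^ 2 : MvPolynomial (Fin 1) ℚ) =
      |(soloInformedCircDeriv t).det|
    rw [soloInformed_abs_det_circDeriv (hS0 t ht)]
    simp [pow_two]
  have hfun : IsSemialgebraicFunOn ℚ S (fun t => R.integrand (soloInformedCircMap t) *
      |(soloInformedCircDeriv t).det|) :=
    (IsSemialgebraicFunOn.mul_holds
      (IsSemialgebraicFunOn.comp_isSemialgebraicMapOn_holds R.isSemialgebraicFunOn_integrand hΦ
        hmaps) hjac).congr fun _ _ => rfl
  have hint : IntegrableOn (fun t => R.integrand (soloInformedCircMap t) *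
      |(soloInformedCircDeriv t).det|) S := by
    have h := (integrableOn_image_iff_integrableOn_abs_det_fderiv_smul volume
      (IsSemialgebraic.measurableSet_holds hS) hderiv hinj R.integrand).1 (by
        rw [himage]; exact R.integrableOn)
    refine h.congr_fun (fun t _ => ?_) (IsSemialgebraic.measurableSet_holds hS)
    show |(soloInformedCircDeriv t).det| • R.integrand (soloInformedCircMap t) = _
    rw [smul_eq_mul, mul_comm]
  refine ⟨⟨S, _, hS, hfun, hint⟩, rfl, rfl, ?_⟩
  exact ⟨1, ⟨S, _, hS, hfun, hint⟩, R, soloInformedCircMap, soloInformedCircDeriv, hΦ, hderiv, hinj,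
    himage.symm, fun t _ => rfl, rfl⟩

/-! ## The class of integrands rational in `(x, √(1 − x²))` -/

/-- `r = [D, f]` of dimension `1` has `D ⊆ (−1, 1]` and integrand `P(τ(x))/Q(τ(x))` on `D`,
`τ(x) = √((1−x)/(1+x))`, for some `P, Q ∈ K[X]` with `Q(τ(x)) ≠ 0` on `D`.  (Functions rational in
`(x, √(1 − x²))` with coefficients in `K` are exactly of this form on `(−1, 1]`:
`x = (1 − τ²)/(1 + τ²)`, `√(1 − x²) = 2τ/(1 + τ²)`, `τ = √(1 − x²)/(1 + x)`.) -/
def SoloInformedIsKCircleOne (r : IntegralRep 1) : Prop :=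
  ∃ P Q : (algebraicClosure ℚ ℝ)[X],
    (∀ x ∈ r.domain, -1 < x 0 ∧ x 0 ≤ 1 ∧
      (Polynomial.aeval (soloInformedCircInv (x 0)) Q : ℝ) ≠ 0) ∧
    EqOn r.integrand (fun x => (Polynomial.aeval (soloInformedCircInv (x 0)) P : ℝ) /
      Polynomial.aeval (soloInformedCircInv (x 0)) Q) r.domain

/-- **After the circle substitution the integrand is `K`-rational**: `4t P(t) / ((1+t²)² Q(t))`. -/
theorem soloInformed_isKRationalOne_circSubst (r : IntegralRep 1) (hr : SoloInformedIsKCircleOne r)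
    (R' : IntegralRep 1)
    (hdom : R'.domain = {t | t ∈ {t : Fin 1 → ℝ | 0 ≤ t 0} ∧ soloInformedCircMap t ∈ r.domain})
    (hint : R'.integrand = fun t => r.integrand (soloInformedCircMap t) *
      |(soloInformedCircDeriv t).det|) : SoloInformedIsKRationalOne R' := by
  obtain ⟨P, Q, hq, hpq⟩ := hr
  have hmem : ∀ t ∈ R'.domain, 0 ≤ t 0 ∧ soloInformedCircMap t ∈ r.domain := fun t ht => by
    rw [hdom] at ht; exact ht
  have hτ : ∀ t : Fin 1 → ℝ, 0 ≤ t 0 → soloInformedCircInv (soloInformedCircMap t 0) = t 0 :=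
    fun t ht => by rw [soloInformed_circMap_apply]; exact soloInformed_circInv_circMap ht
  refine ⟨P * (Polynomial.C (4 : algebraicClosure ℚ ℝ) * Polynomial.X),
    Q * (1 + Polynomial.X ^ 2) ^ 2, fun t ht => ?_, fun t ht => ?_⟩
  · obtain ⟨ht0, hx⟩ := hmem t ht
    have h := (hq _ hx).2.2
    rw [hτ t ht0] at h
    rw [map_mul, map_pow, map_add, map_one, map_pow, Polynomial.aeval_X]
    exact mul_ne_zero h (by positivity)
  · obtain ⟨ht0, hx⟩ := hmem t ht
    rw [hint]
    show r.integrand (soloInformedCircMap t) * |(soloInformedCircDeriv t).det| = _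
    rw [hpq hx, soloInformed_abs_det_circDeriv ht0]
    show (Polynomial.aeval (soloInformedCircInv (soloInformedCircMap t 0)) P : ℝ) /
        Polynomial.aeval (soloInformedCircInv (soloInformedCircMap t 0)) Q *
          (4 * t 0 / (1 + t 0 * t 0) ^ 2) =
      (Polynomial.aeval (t 0) (P * (Polynomial.C (4 : algebraicClosure ℚ ℝ) * Polynomial.X)) : ℝ) /
        Polynomial.aeval (t 0) (Q * (1 + Polynomial.X ^ 2) ^ 2)
    have hQ : (Polynomial.aeval (t 0) Q : ℝ) ≠ 0 := by
      have h := (hq _ hx).2.2; rwa [hτ t ht0] at h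
    rw [hτ t ht0, map_mul, map_mul, Polynomial.aeval_X, Polynomial.aeval_C, map_mul, map_pow,
      map_add, map_one, map_pow, Polynomial.aeval_X, map_ofNat]
    have h1 := soloInformed_one_add_mul_self_ne_zero (t 0)
    field_simp

/-- **Members of the circle class lie in the span of points and segments.** -/
theorem soloInformed_segSpan_of_isKCircleOne (r : IntegralRep 1) (hr : SoloInformedIsKCircleOne r) :
    of r ∈ soloInformedSegSpan := by
  obtain ⟨P, Q, hq, hpq⟩ := hr
  obtain ⟨R', hdom, hint, hrel⟩ :=
    soloInformed_exists_circSubst r fun x hx => ⟨(hq x hx).1, (hq x hx).2.1⟩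
  have hR' : SoloInformedIsKRationalOne R' :=
    soloInformed_isKRationalOne_circSubst r ⟨P, Q, hq, hpq⟩ R' hdom hint
  have h1 : of r - of R' ∈ relations := by
    have h := relations.neg_mem (changeOfVariablesRel_subset_relations hrel)
    rwa [neg_sub] at h
  exact soloInformed_mem_segSpan_of_sub_mem h1 (soloInformed_segSpan_of_isKRationalOne R' hR')

/-- **The Kontsevich–Zagier period conjecture for one-variable integrands rational in
`(x, √(1 − x²))` with real algebraic coefficients** (unconditional; `D, D' ⊆ (−1, 1]`
`ℚ`-semialgebraic): equal values ⇒ KZ-equivalent; likewise against the `K`-rational class and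
against rational representations of dimension `≤ 1`. [Kontsevich–Zagier 2001, §1.1, §1.2
Question 1; this work] -/
theorem soloInformed_kzp_isKCircleOne (r r' : IntegralRep 1) (hr : SoloInformedIsKCircleOne r)
    (hr' : SoloInformedIsKCircleOne r') :
    (r.value = r'.value → Equivalent r r') ∧
    (∀ r₁ : IntegralRep 1, SoloInformedIsKRationalOne r₁ → r.value = r₁.value → Equivalent r r₁) ∧
    (∀ {n : ℕ} (hn : n ≤ 1) (r₀ : IntegralRep n), r₀.IsRational → r.value = r₀.value →
      Equivalent r r₀) := by
  have h := soloInformed_segSpan_of_isKCircleOne r hr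
  exact ⟨fun hv => soloInformed_equivalent_of_mem_segSpan h
      (soloInformed_segSpan_of_isKCircleOne r' hr') hv,
    fun r₁ hr₁ hv => soloInformed_equivalent_of_mem_segSpan h
      (soloInformed_segSpan_of_isKRationalOne r₁ hr₁) hv,
    fun hn r₀ hr₀ hv => soloInformed_equivalent_of_mem_segSpan h
      (soloInformed_of_mem_segSpan_of_isRational hn r₀ hr₀) hv⟩

/-! ## Kontsevich–Zagier's examples: `√(1 − x²)` and `1/√(1 − x²)` -/

/-- On `(−1, 1]`: `√(1 − x²) = 2τ(x)/(1 + τ(x)²)`. -/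
theorem soloInformed_sqrt_one_sub_sq {x : ℝ} (hx1 : -1 < x) (hx2 : x ≤ 1) :
    Real.sqrt (1 - x ^ 2) =
      2 * soloInformedCircInv x / (1 + soloInformedCircInv x * soloInformedCircInv x) := by
  obtain ⟨hτ0, hsq, -⟩ := soloInformed_circMap_circInv hx1 hx2
  have hpos : 0 < 1 + x := by linarith
  have h1x : (1 : ℝ) + (1 - x) / (1 + x) = 2 / (1 + x) := by field_simp; first | done | ring
  rw [hsq, h1x]
  have hprod : 1 - x ^ 2 = (1 + x) * (1 + x) * ((1 - x) / (1 + x)) := by field_simp; first | done | ring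
  rw [hprod, Real.sqrt_mul (mul_self_nonneg _), Real.sqrt_mul_self hpos.le]
  show (1 + x) * soloInformedCircInv x = _
  field_simp

/-- `[D, √(1 − x²)]` (`D ⊆ (−1, 1]`) is in the circle class. [KZ 2001, §1.1] -/
theorem soloInformed_isKCircleOne_sqrt (r : IntegralRep 1) (hD : ∀ x ∈ r.domain, -1 < x 0 ∧ x 0 ≤ 1)
    (hf : EqOn r.integrand (fun x => Real.sqrt (1 - x 0 ^ 2)) r.domain) :
    SoloInformedIsKCircleOne r := by
  refine ⟨Polynomial.C (2 : algebraicClosure ℚ ℝ) * Polynomial.X, 1 + Polynomial.X ^ 2,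
    fun x hx => ⟨(hD x hx).1, (hD x hx).2, ?_⟩, fun x hx => ?_⟩
  · rw [map_add, map_one, map_pow, Polynomial.aeval_X]; positivity
  · rw [hf hx]
    show Real.sqrt (1 - x 0 ^ 2) =
      (Polynomial.aeval (soloInformedCircInv (x 0))
          (Polynomial.C (2 : algebraicClosure ℚ ℝ) * Polynomial.X) : ℝ) /
        Polynomial.aeval (soloInformedCircInv (x 0)) (1 + Polynomial.X ^ 2 : (algebraicClosure ℚ ℝ)[X])
    rw [soloInformed_sqrt_one_sub_sq (hD x hx).1 (hD x hx).2, map_mul, Polynomial.aeval_C,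
      Polynomial.aeval_X, map_add, map_one, map_pow, Polynomial.aeval_X, map_ofNat, pow_two]

/-- `[D, 1/√(1 − x²)]` (`D ⊆ (−1, 1)`) is in the circle class. [KZ 2001, §1.1] -/
theorem soloInformed_isKCircleOne_inv_sqrt (r : IntegralRep 1)
    (hD : ∀ x ∈ r.domain, -1 < x 0 ∧ x 0 < 1)
    (hf : EqOn r.integrand (fun x => (Real.sqrt (1 - x 0 ^ 2))⁻¹) r.domain) :
    SoloInformedIsKCircleOne r := by
  refine ⟨1 + Polynomial.X ^ 2, Polynomial.C (2 : algebraicClosure ℚ ℝ) * Polynomial.X,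
    fun x hx => ⟨(hD x hx).1, (hD x hx).2.le, ?_⟩, fun x hx => ?_⟩
  · obtain ⟨h1, h2⟩ := hD x hx
    rw [map_mul, Polynomial.aeval_C, Polynomial.aeval_X, map_ofNat]
    refine mul_ne_zero two_ne_zero fun h0 => ?_
    obtain ⟨-, hsq, -⟩ := soloInformed_circMap_circInv h1 h2.le
    rw [h0, zero_mul] at hsq
    have hpos : 0 < (1 - x 0) / (1 + x 0) := div_pos (by linarith) (by linarith)
    linarith
  · rw [hf hx]
    show (Real.sqrt (1 - x 0 ^ 2))⁻¹ =
      (Polynomial.aeval (soloInformedCircInv (x 0)) (1 + Polynomial.X ^ 2 : (algebraicClosure ℚ ℝ)[X]) : ℝ) /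
        Polynomial.aeval (soloInformedCircInv (x 0))
          (Polynomial.C (2 : algebraicClosure ℚ ℝ) * Polynomial.X)
    rw [soloInformed_sqrt_one_sub_sq (hD x hx).1 (hD x hx).2.le, map_mul, Polynomial.aeval_C,
      Polynomial.aeval_X, map_add, map_one, map_pow, Polynomial.aeval_X, map_ofNat, pow_two, inv_div]

end Summit.KontsevichZagierPeriods.KontsevichZagierPeriods.Theorems
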